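import Literature.NumberTheory.DiophantineGeometry.SymmetricGroupReps
import Mathlib.Data.Complex.Basic
import HarnessLib

/-!
# Bessenrodt–Behns 2004, Cor. 3.2: a self-conjugate character is a constituent of its Kronecker
# square (named fact)

C. Bessenrodt, C. Behns, *On the Durfee size of Kronecker products of characters of the symmetric
group and its double covers*, J. Algebra **280** (2004) 132–144 [BessenrodtBehns2004] (held text
`paper:doi-10-1016-j-jalgebra-2004-03-028`), §3, Cor. 3.2 (p. 135 = p0004:L70–71): "Let `λ = λ'` be a
partition. Then `[λ]` is a constituent of `[λ]²`. More precisely, it is a constituent of multiplicity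
`≡ 1 mod 4`." Notation (§2, p. 134 = p0003): `[λ]` is the irreducible character of `S_n` labelled by
`λ ⊢ n`, `[λ] · [μ]` the Kronecker (inner tensor) product, `[λ]² = [λ] · [λ]`, `λ'` the conjugate
partition, and `c^ν_{λμ} = ⟨[λ] · [μ], [ν]⟩` "the multiplicity of `[ν]` in the Kronecker product
`[λ] · [μ]`" — the tree's `kroneckerCoeff ℂ λ μ ν` (`SymmetricGroupReps.lean`: the multiplicity of
`S^ν` in `S^λ ⊗ S^μ`), conjugation being the tree's `Nat.Partition.transpose`
(`PartitionTableaux.lean`). The printed proof goes through the `A_n`-characters `{λ}±` and their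
values on the critical classes of cycle type `h(λ)` (the principal hook lengths; Thm. 3.1), not
reproduced here; the Remark after the corollary (p. 136 = p0005:L32–34) records the special case of
square partitions `λ = (a^a)` ("a positive answer to a question posed by Vallejo"), the form in which
Amanov–Yeliussizov (IMRN 2023, Lemma 2.1: "Square positivity [bb04]:
`g(k × k, k × k, k × k) > 0` for every `k`") and the tree's
`Literature/Computability/AlgebraicComplexity/BI17GenericPeriodPolystableWitnessProofs.lean` consume it.

STATEMENT ONLY (a named fact, D-0014); no proof in the tree. Honest framing: a classical published
theorem of the representation theory of `S_n`, typed for the cell `val-lit` (LADDER-VALIANT V3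
bookkeeping); nothing here bears on VP versus VNP.

## References

* [BessenrodtBehns2004] C. Bessenrodt, C. Behns, *On the Durfee size of Kronecker products of
  characters of the symmetric group and its double covers*, J. Algebra 280 (2004) 132–144,
  doi:10.1016/j.jalgebra.2004.03.028, Thm. 3.1, Cor. 3.2 and the Remark following it.
* A. Amanov, D. Yeliussizov, *Fundamental invariants of tensors, Latin hypercubes, and rectangular
  Kronecker coefficients*, IMRN 2023 (arXiv:2202.11059), Lemma 2.1 (the square case, as quoted).
-/

namespace Literature.RepresentationTheory.FiniteGroups

open Literature.NumberTheory.DiophantineGeometry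

/-- **Bessenrodt–Behns 2004, Cor. 3.2** (J. Algebra 280, p. 135): "Let `λ = λ'` be a partition. Then
`[λ]` is a constituent of `[λ]²`. More precisely, it is a constituent of multiplicity `≡ 1 mod 4`."
Typed over `ℂ` with the multiplicity `c^λ_{λλ} = kroneckerCoeff ℂ λ λ λ` of `[λ]` in `[λ] · [λ]` and
`λ' = λ.transpose`: the multiplicity is positive and congruent to `1` modulo `4`.
[cite: BessenrodtBehns2004, Cor. 3.2] -/
def BessenrodtBehns2004_cor_3_2 : Prop :=
  ∀ (n : ℕ) (lam : Nat.Partition n), lam.transpose = lam →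
    0 < kroneckerCoeff ℂ lam lam lam ∧ kroneckerCoeff ℂ lam lam lam % 4 = 1

end Literature.RepresentationTheory.FiniteGroups
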